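import Mathlib
import Summits.ValiantsHypothesis.ValiantsHypothesis.Theorems.NewtonUnitEquationsNewtonTauWeakCornerDefs
import Summits.ValiantsHypothesis.ValiantsHypothesis.Theorems.NewtonUnitEquationsNewtonTauWeakVdpDefs

/-!
# `NewtonTauWeak` (stmt-ValiantsHypothesis-5904), line `binomial-normal-form`: objects of the
# POLYNOMIAL-IDENTITY route to the `K = 3` sub-stub `fixedKCoincidence_t2_K3`

Route-posited objects (D-0016 `…Defs` file) for the siege variation "polynomial identity route" of the
registered sub-stub `fixedKCoincidence_t2_K3` of `stub_binomialNewtonTauCommon` (KPTT arXiv:1308.2286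
Conj. 1 at `t = 2`, `K = 3` products, exponent lists without short 2-vs-1 relations among their direction
lines).  The global assembly of lead c2's plan (`Cruxes/NewtonTauWeak/Lines/binomial-normal-form-ltc.md`
§2–§5) is carried out in the ring of bivariate LAURENT polynomials
`Laur = AddMonoidAlgebra ℂ (Fin 2 → ℤ)`, where the flip identity
`1 - ρ X^d = X^d · (X^{-d} - ρ)` is an honest identity and no power series are needed: the three products
become, after the common monomial `X^{μ_S}` is taken out, a sum of three SEPARATED Laurent products over the
flipped direction lines, and truncated division is the polynomial identity `C · U = A + s^{D+1} R`.

Objects (all [folklore]):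
* `latt` — the lattice embedding `ℕ² → ℤ²` as an additive hom, and `toL` — the induced (injective) ring hom
  `ℂ[X,Y] → Laur`;
* `IsTopL w x v` — `v` is THE strict `w`-top lattice point of the Laurent polynomial `x` (same convention as
  the vdp line's `IsTop`, weights `wt` of `…CornerDefs`);
* `sepL E U` — the separated Laurent product `Π_e U_e(X^{E_e})` of univariate polynomials along integer
  directions;
* `posSet d w` — the cell datum of a weight: the set of exponent indices of positive weight;
* `dgcd v`, `prim v` — multiplicity and primitive direction of a nonzero exponent `v ∈ ℕ²`
  (`v = dgcd v • prim v`), so that parallel exponents share one primitive direction (the direction LINES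
  of the stub's hypothesis).
Besides the definitions only two routine API lemmas (`latt_apply`, `wdeg_eq_wt`, the latter registered so
that this file rides `--supports`); the users are the `…NewtonTauWeakPir*.lean` files of this variation.
-/

-- the namespace mandated for this Theorems file repeats the component `ValiantsHypothesis`
set_option linter.dupNamespace false

noncomputable section

open scoped BigOperators Polynomial

namespace Summit.ValiantsHypothesis.ValiantsHypothesis.Theorems.NewtonTauWeakPir

open Summit.ValiantsHypothesis.ValiantsHypothesis.Theorems.NewtonTauWeakCorner (wt)
open Summit.ValiantsHypothesis.ValiantsHypothesis.Theorems.NewtonTauWeakVdp (wdeg)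

/-- The ring of bivariate Laurent polynomials over `ℂ`: the additive monoid algebra of the lattice `ℤ²`.
[folklore] -/
abbrev Laur : Type := AddMonoidAlgebra ℂ (Fin 2 → ℤ)

/-- The lattice embedding of exponents `ℕ² → ℤ²` (coordinatewise cast), as an additive monoid hom.
[folklore] -/
def latt : (Fin 2 →₀ ℕ) →+ (Fin 2 → ℤ) where
  toFun e := fun i => ((e i : ℕ) : ℤ)
  map_zero' := by funext i; simp
  map_add' a b := by funext i; simp

/-- The embedding of bivariate polynomials into Laurent polynomials induced by `latt` (a ring hom).
[folklore] -/
def toL : MvPolynomial (Fin 2) ℂ →+* Laur :=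
  AddMonoidAlgebra.mapDomainRingHom ℂ latt

/-- `v` is THE strict `w`-top lattice point of the Laurent polynomial `x`: its coefficient is nonzero and
every other lattice point with nonzero coefficient weighs strictly less. [folklore] -/
def IsTopL (w : Fin 2 → ℝ) (x : Laur) (v : Fin 2 → ℤ) : Prop :=
  x.coeff v ≠ 0 ∧ ∀ z, x.coeff z ≠ 0 → z ≠ v → wt w z < wt w v

/-- The separated Laurent product `Π_e U_e(X^{E_e})` of univariate polynomials `U_e` along integer
directions `E_e ∈ ℤ²`. [folklore] -/
def sepL {s : ℕ} (E : Fin s → Fin 2 → ℤ) (U : Fin s → ℂ[X]) : Laur :=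
  ∏ e, Polynomial.aeval (AddMonoidAlgebra.single (E e) (1 : ℂ) : Laur) (U e)

/-- The cell datum of a real weight `w` for an exponent list `d`: the indices of positive weight
(`{j : ⟨w, d_j⟩ > 0}`). [folklore] -/
def posSet {N : ℕ} (d : Fin N → (Fin 2 →₀ ℕ)) (w : Fin 2 → ℝ) : Finset (Fin N) :=
  Finset.univ.filter fun j =>
    0 < wdeg w (d j)

/-- The multiplicity of an exponent `v ∈ ℕ²`: the gcd of its two coordinates (`0` only for `v = 0`).
[folklore] -/
def dgcd (v : Fin 2 →₀ ℕ) : ℕ := Nat.gcd (v 0) (v 1)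

/-- The primitive direction of an exponent `v ∈ ℕ²`: `v` divided coordinatewise by its multiplicity, as a
lattice vector (`prim 0 = 0`; for `v ≠ 0`, `latt v = dgcd v • prim v` and `prim v` has coprime
coordinates). [folklore] -/
def prim (v : Fin 2 →₀ ℕ) : Fin 2 → ℤ := fun i => ((v i / dgcd v : ℕ) : ℤ)

/-! ## Routine API -/

/-- Coordinates of the lattice embedding. [folklore] -/
@[simp] theorem latt_apply (e : Fin 2 →₀ ℕ) (i : Fin 2) : latt e i = ((e i : ℕ) : ℤ) := rfl

/-- The weighted degree of an exponent (vdp line) is the corner-model weight of its lattice point.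
[folklore] -/
theorem wdeg_eq_wt (w : Fin 2 → ℝ) (e : Fin 2 →₀ ℕ) : wdeg w e = wt w (latt e) := by
  simp [wdeg, wt, latt]

end Summit.ValiantsHypothesis.ValiantsHypothesis.Theorems.NewtonTauWeakPir

end
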